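import Mathlib.Analysis.SpecialFunctions.BinaryEntropy
import Mathlib.Analysis.Convex.Slope
import HarnessLib

/-!
# Modulus of continuity of the binary entropy function

Topic `Literature/Analysis/SpecialFunctions`. Mathlib has the binary entropy (in nats)
`Real.binEntropy p = -p log p - (1-p) log (1-p)`, its concavity on `[0, 1]`
(`Real.strictConcave_binEntropy`) and symmetry `H(1-p) = H(p)`, but no modulus of continuity. We
prove the classical one (the `n = 2` case of the Fannes–Audenaert / Zhang continuity bound for
the Shannon entropy, where it is sharp):

* `increment_le_of_concaveOn` — increments of a concave function on an interval decrease: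
  `f (x + d) - f x ≤ f (a + d) - f a` for `a ≤ x` (secant slopes, Mathlib `ConvexOn.secant_mono`);
* `abs_binEntropy_sub_binEntropy_le` — **`|H(p) - H(q)| ≤ H(|p - q|)` for `p, q ∈ [0, 1]`**
  (concavity gives `H(x + d) - H(x) ≤ H(d) - H(0) = H(d)`; the symmetry `H(1 - ·) = H` gives the
  other sign);
* `binEntropy_le_mul_one_sub_log` — **`H(d) ≤ d (1 - log d)`** for `0 ≤ d ≤ 1`
  (`-(1-d) log(1-d) ≤ d`), so that `|H(p) - H(q)| ≤ |p - q| (1 + log (1/|p - q|))`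
  (`abs_binEntropy_sub_binEntropy_le_mul`): the entropy is `d log(1/d)`-continuous.

## References

* Z. Zhang, *Estimating mutual information via Kolmogorov distance*, IEEE Trans. Inform. Theory
  53 (2007) 3280–3282 (sharp continuity bound `|H(P) - H(Q)| ≤ … + h(δ)`); K. M. R. Audenaert,
  J. Phys. A 40 (2007) 8127–8136, Thm. 1. The binary case proved here is elementary (folklore).
-/

noncomputable section

open Set Real

namespace Literature.Analysis.SpecialFunctions.Real

/-! ### Increments of concave functions decrease -/

/-- **Secant slopes of a convex function increase with the interval**: for `f` convex on a convex
set `s ∋ a, a + d, x, x + d` with `a ≤ x` and `0 < d`, the slope over `[a, a + d]` is at most the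
slope over `[x, x + d]`; in increment form `f (a + d) - f a ≤ f (x + d) - f x`. [folklore] -/
theorem increment_le_of_convexOn {s : Set ℝ} {f : ℝ → ℝ} (hf : ConvexOn ℝ s f) {a x d : ℝ}
    (ha : a ∈ s) (had : a + d ∈ s) (hx : x ∈ s) (hxd : x + d ∈ s) (hax : a ≤ x) (hd : 0 ≤ d) :
    f (a + d) - f a ≤ f (x + d) - f x := by
  rcases hd.eq_or_lt with rfl | hd
  · simp
  rcases hax.eq_or_lt with rfl | hax
  · exact le_rfl
  -- slope(a, a+d) ≤ slope(a, x+d) ≤ slope(x, x+d)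
  have h1 : (f (a + d) - f a) / (a + d - a) ≤ (f (x + d) - f a) / (x + d - a) :=
    hf.secant_mono ha had hxd (by linarith) (by linarith) (by linarith)
  have h2 : (f a - f (x + d)) / (a - (x + d)) ≤ (f x - f (x + d)) / (x - (x + d)) :=
    hf.secant_mono hxd ha hx (by linarith) (by linarith) hax.le
  have h2' : (f (x + d) - f a) / (x + d - a) ≤ (f (x + d) - f x) / (x + d - x) := by
    have e1 : (f a - f (x + d)) / (a - (x + d)) = (f (x + d) - f a) / (x + d - a) := by
      rw [← neg_div_neg_eq]; ring_nf
    have e2 : (f x - f (x + d)) / (x - (x + d)) = (f (x + d) - f x) / (x + d - x) := by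
      rw [← neg_div_neg_eq]; ring_nf
    rwa [e1, e2] at h2
  have h3 := h1.trans h2'
  rw [show a + d - a = d by ring, show x + d - x = d by ring, div_le_div_iff_of_pos_right hd] at h3
  exact h3

/-- **Increments of a concave function decrease**: for `f` concave on a convex set
`s ∋ a, a + d, x, x + d` with `a ≤ x`, `0 ≤ d`: `f (x + d) - f x ≤ f (a + d) - f a`. [folklore] -/
theorem increment_le_of_concaveOn {s : Set ℝ} {f : ℝ → ℝ} (hf : ConcaveOn ℝ s f) {a x d : ℝ}
    (ha : a ∈ s) (had : a + d ∈ s) (hx : x ∈ s) (hxd : x + d ∈ s) (hax : a ≤ x) (hd : 0 ≤ d) :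
    f (x + d) - f x ≤ f (a + d) - f a := by
  have h := increment_le_of_convexOn hf.neg ha had hx hxd hax hd
  simp only [Pi.neg_apply] at h
  linarith

/-! ### The binary entropy is `H(·)`-continuous -/

/-- One-sided form: `H(x + d) - H(x) ≤ H(d)` for `0 ≤ x`, `0 ≤ d`, `x + d ≤ 1` (concavity of `H`
on `[0, 1]` and `H(0) = 0`). [folklore] -/
theorem binEntropy_add_sub_binEntropy_le {x d : ℝ} (hx : 0 ≤ x) (hd : 0 ≤ d) (hxd : x + d ≤ 1) :
    binEntropy (x + d) - binEntropy x ≤ binEntropy d := by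
  have h := increment_le_of_concaveOn strictConcave_binEntropy.concaveOn (a := 0) (x := x) (d := d)
    ⟨le_rfl, zero_le_one⟩ ⟨by linarith, by linarith⟩ ⟨hx, by linarith⟩ ⟨by linarith, hxd⟩ hx hd
  simpa using h

/-- **`|H(p) - H(q)| ≤ H(|p - q|)` for `p, q ∈ [0, 1]`** (the binary case of the
Fannes–Audenaert–Zhang continuity bound; from concavity and the symmetry `H(1 - ·) = H`).
[folklore] -/
theorem abs_binEntropy_sub_binEntropy_le {p q : ℝ} (hp : p ∈ Icc (0 : ℝ) 1)
    (hq : q ∈ Icc (0 : ℝ) 1) : |binEntropy p - binEntropy q| ≤ binEntropy |p - q| := by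
  -- reduce to `p ≤ q`
  wlog hpq : p ≤ q generalizing p q
  · have h := this hq hp (le_of_not_ge hpq)
    rwa [abs_sub_comm, abs_sub_comm q p] at h
  have hd : 0 ≤ q - p := by linarith
  rw [abs_sub_comm p q, abs_of_nonneg hd, abs_le]
  constructor
  · -- `H(q) - H(p) ≤ H(q - p)` by concavity
    have h := binEntropy_add_sub_binEntropy_le (x := p) (d := q - p) hp.1 hd (by linarith [hq.2])
    rw [show p + (q - p) = q by ring] at h
    linarith
  · -- `H(p) - H(q) ≤ H(q - p)` via the reflection `x ↦ 1 - x`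
    have h := binEntropy_add_sub_binEntropy_le (x := 1 - q) (d := q - p) (by linarith [hq.2]) hd
      (by linarith [hp.1])
    rw [show 1 - q + (q - p) = 1 - p by ring, binEntropy_one_sub, binEntropy_one_sub] at h
    linarith

/-- **`H(d) ≤ d (1 - log d)` for `0 ≤ d ≤ 1`** (`-(1 - d) log (1 - d) ≤ d` since
`-log(1 - d) ≤ d/(1 - d)`; at `d = 0, 1` both sides vanish / equal `1`). [folklore] -/
theorem binEntropy_le_mul_one_sub_log {d : ℝ} (hd0 : 0 ≤ d) (hd1 : d ≤ 1) :
    binEntropy d ≤ d * (1 - log d) := by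
  rcases hd1.eq_or_lt with rfl | hd1
  · simp
  have h1 : -((1 - d) * log (1 - d)) ≤ d := by
    have hpos : 0 < 1 - d := by linarith
    -- `log (1 - d) ≥ 1 - 1/(1 - d) = -d/(1 - d)`
    have hlog : 1 - (1 - d)⁻¹ ≤ log (1 - d) := one_sub_inv_le_log_of_pos hpos
    have : (1 - d) * (1 - (1 - d)⁻¹) = -d := by field_simp; ring
    nlinarith [mul_le_mul_of_nonneg_left hlog hpos.le]
  rw [binEntropy, log_inv, log_inv]
  nlinarith

/-- **Explicit modulus: `|H(p) - H(q)| ≤ |p - q| (1 - log |p - q|)`** for `p, q ∈ [0, 1]`.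
[folklore] -/
theorem abs_binEntropy_sub_binEntropy_le_mul {p q : ℝ} (hp : p ∈ Icc (0 : ℝ) 1)
    (hq : q ∈ Icc (0 : ℝ) 1) :
    |binEntropy p - binEntropy q| ≤ |p - q| * (1 - log |p - q|) :=
  (abs_binEntropy_sub_binEntropy_le hp hq).trans
    (binEntropy_le_mul_one_sub_log (abs_nonneg _) (by
      rw [abs_le]; constructor <;> linarith [hp.1, hp.2, hq.1, hq.2]))

/-- Monotone form of the modulus: for `|p - q| ≤ d ≤ 1`, `|H(p) - H(q)| ≤ d (1 - log d)`
(`x (1 - log x)` is nondecreasing on `(0, 1]`, derivative `-log x ≥ 0`). [folklore] -/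
theorem abs_binEntropy_sub_binEntropy_le_of_le {p q d : ℝ} (hp : p ∈ Icc (0 : ℝ) 1)
    (hq : q ∈ Icc (0 : ℝ) 1) (hpq : |p - q| ≤ d) (hd1 : d ≤ 1) :
    |binEntropy p - binEntropy q| ≤ d * (1 - log d) := by
  have h0 : 0 ≤ |p - q| := abs_nonneg _
  refine (abs_binEntropy_sub_binEntropy_le_mul hp hq).trans ?_
  -- monotonicity of `x ↦ x (1 - log x)` on `[0, 1]`
  rcases h0.eq_or_lt with h | h
  · rw [← h]
    simp only [zero_mul]
    have hd0 : 0 ≤ d := h.symm ▸ hpq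
    have : log d ≤ 0 := log_nonpos hd0 hd1
    nlinarith
  · have hd0 : 0 < d := h.trans_le hpq
    -- `x - x log x` is monotone on `[|p-q|, d]` : compare via the mean value inequality
    have hmono : MonotoneOn (fun x : ℝ ↦ x * (1 - log x)) (Icc |p - q| d) := by
      refine monotoneOn_of_deriv_nonneg (convex_Icc _ _) ?_ ?_ ?_
      · exact (continuousOn_id.mul (continuousOn_const.sub
          (continuousOn_log.mono fun x hx ↦ (h.trans_le hx.1).ne'))).mono le_rfl
      · intro x hx
        rw [interior_Icc] at hx
        have hx0 : x ≠ 0 := (h.trans hx.1).ne'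
        exact (((differentiableAt_id).mul ((differentiableAt_const _).sub
          (differentiableAt_log hx0))).differentiableWithinAt)
      · intro x hx
        rw [interior_Icc] at hx
        have hx0 : 0 < x := h.trans hx.1
        have hx1 : x ≤ 1 := hx.2.le.trans hd1
        have hderiv : deriv (fun x : ℝ ↦ x * (1 - log x)) x = -log x := by
          have h1 : HasDerivAt (fun x : ℝ ↦ x * (1 - log x)) (1 * (1 - log x) + x * (0 - x⁻¹)) x :=
            (hasDerivAt_id x).mul ((hasDerivAt_const x (1 : ℝ)).sub (hasDerivAt_log hx0.ne'))
          rw [h1.deriv]; field_simp; ring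
        rw [hderiv]
        have := log_nonpos hx0.le hx1
        linarith
    exact hmono ⟨le_rfl, hpq⟩ ⟨hpq, le_rfl⟩ hpq

end Literature.Analysis.SpecialFunctions.Real

end
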